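import Summits.AtomisticToContinuum.Crystallization.Theorems.FrustratedLawDichotomyCellZFrame
import Summits.AtomisticToContinuum.Crystallization.Theorems.FrustratedLawDichotomyZoneFloorComplete
import Summits.AtomisticToContinuum.Crystallization.Theorems.FrustratedLawDichotomyCellHalo

/-!
# FrustratedLawDichotomy · crux `AperiodicFrustratedLawGap` (stmt-AtomisticToContinuum-27623) — THE CLASS-Z CELL FRAME, part II:
# ★ the generic Z ROW FLOORS `rowFloorZ₁'/₂'_of_cells` and their TABLE packaging over the grid-point templates
# (ZONE-TRANSPORT class Z; KFILE amendment D FINAL §D2, crit r1865 (B); on hand-1's (369) `…ZoneFloorComplete`; cell decomp-a2c, lens-5 g114)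

The class-A pattern ((251) `rowFloor_of_cells` → (252) tables) for class Z.  For a configuration `μ` in the Z row `rowZ B MF posF nF sF …`
(coherent with the grid-point template on the halo window AND D-facing at some grid point `k ∈ B`), the LITERAL inequality of the cell,
stated ONCE over the decided envelopes `W⁺ ⊇ MF k` (floors `vlo ≤ 0`) and `K ⊆ MF k ∖ root` (refunds `kw ≥ 0`), is pushed through the two
monotonicities (part I `sum_erase_le_of_subset_of_nonpos`, `sum_le_of_subset_of_nonneg`) and the label ↔ position re-indexing ((253) `labOf`) into
(369) `floor_transport_of_zoneFloor₁'` (branch 1: refunds against the zone tail) resp. `floor_transport_of_zoneFloor₂'` (branch 2: half-space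
column), with the root MARKED by the registry (`hmark`, in production `…ZoneKernel.hostLikeAt_zero_of_mem`) and the D-facing clause read
pointwise (`…ZoneKernel.dFacing_pointwise`).  NASH IS NOT USED.
* §1 re-indexing: `image_erase_eq`, `sum_labOf_image_erase`;
* §2 ★ `rowFloorZ₁_of_cells'`, `rowFloorZ₂_of_cells'` (semantic hypotheses per grid point);
* §3 ★★ `rowFloorZ₁_of_tables'`, `rowFloorZ₂_of_tables'` — the K-file form over `cellRowZ` (grid `gridZ B N J`, templates `tplZ`, windows
  `nL/sL`): box brackets `N_lo ≤ ‖F n₁‖ ≤ N_hi`, `g_lo ≤ gram ≤ g_hi`, `r_lo ≤ ‖F a z‖ ≤ r_hi`, the decided tables of part I §2, the scalar facts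
  `τ·N_hi ≤ S_lo`, `J ⊆ [S_lo, S_hi]` (+ `N_hi ≤ S_lo` for branch 2), the registry's `hmark`, and ONE literal inequality `hlit`.

House conventions: SI units · italic scalars, bold vectors, sans-serif tensors · numbered formulae only when referenced · en-dash for
ranges · References = cited works, numbered, alphabetical · no footnotes; Remarks at section ends · British spelling, -ise · Lennard-Jones
hyphenated; NASH capitalised as the Statement's notion · "folklore" tags standard bookkeeping; no new references are cited in this file.
-/

noncomputable section

namespace Summit.AtomisticToContinuum.Crystallization.Theorems.FrustratedLawDichotomyCellZFloorFrame

open MeasureTheory Metric Set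
open scoped BigOperators RealInnerProductSpace
open Literature.MathematicalPhysics.StatisticalMechanics (lennardJones rootEnergy)
open Literature.Probability.Process (IsRootedHardCore)
open Summit.AtomisticToContinuum.Crystallization.Theorems.ChargedEnergyGapNegative (E3)
open Summit.AtomisticToContinuum.Crystallization.Theorems.FrustratedLawDichotomySignedLedger (net)
open Summit.AtomisticToContinuum.Crystallization.Theorems.FrustratedLawDichotomyCoherentOn (coherentOn)
open Summit.AtomisticToContinuum.Crystallization.Theorems.FrustratedLawDichotomyCoherentFloor (tailCol)
open Summit.AtomisticToContinuum.Crystallization.Theorems.FrustratedLawDichotomyCoherentFloorHalo (haloWindow halfEnergyCol)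
open Summit.AtomisticToContinuum.Crystallization.Theorems.FrustratedLawDichotomyCellMetric (posL gram posL_zero)
open Summit.AtomisticToContinuum.Crystallization.Theorems.FrustratedLawDichotomyCellHaloNormal (nL sL norm_nL one_le_sL)
open Summit.AtomisticToContinuum.Crystallization.Theorems.FrustratedLawDichotomyCellHalo (labOf labOf_pos)
open Summit.AtomisticToContinuum.Crystallization.Theorems.FrustratedLawDichotomyPullKernel (zonePull)
open Summit.AtomisticToContinuum.Crystallization.Theorems.FrustratedLawDichotomyZoneKernel (DFacing dFacing_pointwise)
open Summit.AtomisticToContinuum.Crystallization.Theorems.FrustratedLawDichotomyZoneFloorComplete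
  (floor_transport_of_zoneFloor₁' floor_transport_of_zoneFloor₂')
open Summit.AtomisticToContinuum.Crystallization.Theorems.FrustratedLawDichotomyCellZFrame

variable {ι : Type*} [DecidableEq ι]

/-! ## §1. Label ↔ position re-indexing on the placed template -/

section Reindex

variable {M : Finset ι} {pos : ι → E3} {o : ι}

omit [DecidableEq ι] in
/-- Placements `2τ`-separated (`τ ≥ 0`) are injective on the label set. [folklore] -/
theorem injOn_of_sep {τ : ℝ} (hτ : 0 ≤ τ) (hsep : ∀ z ∈ M, ∀ z' ∈ M, z ≠ z' → 2 * τ < dist (pos z) (pos z')) : Set.InjOn pos ↑M := by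
  intro z hz z' hz' h
  by_contra hne
  have h1 := hsep z hz z' hz' hne
  rw [h, dist_self] at h1
  linarith

/-- The placed template minus the root point is the image of the labels minus the root label. [folklore] -/
theorem image_erase_eq (hinj : Set.InjOn pos ↑M) (ho : o ∈ M) (h0 : pos o = 0) : (M.image pos).erase 0 = (M.erase o).image pos := by
  ext x
  simp only [Finset.mem_erase, Finset.mem_image]
  constructor
  · rintro ⟨hx0, z, hz, rfl⟩
    exact ⟨z, ⟨fun h => hx0 (by rw [h, h0]), hz⟩, rfl⟩
  · rintro ⟨z, ⟨hzo, hz⟩, rfl⟩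
    refine ⟨fun h => hzo (hinj hz ho (by rw [h, h0])), z, hz, rfl⟩

/-- ★ Sums of a label dial over the placed off-root template are label sums. [folklore] -/
theorem sum_labOf_image_erase (hinj : Set.InjOn pos ↑M) (ho : o ∈ M) (h0 : pos o = 0) (f : ι → ℝ) :
    ∑ x ∈ (M.image pos).erase 0, labOf M pos f x = ∑ z ∈ M.erase o, f z := by
  rw [image_erase_eq hinj ho h0, Finset.sum_image (hinj.mono (Finset.coe_subset.2 (Finset.erase_subset o M)))]
  exact Finset.sum_congr rfl fun z hz => labOf_pos hinj (subset_refl M) f (Finset.mem_of_mem_erase hz)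

omit [DecidableEq ι] in
/-- Members of the placed off-root template are placed off-root labels. [folklore] -/
theorem exists_label_of_mem_image_erase (h0 : pos o = 0) {x : E3} (hx : x ∈ (M.image pos).erase 0) : ∃ z ∈ M, z ≠ o ∧ pos z = x := by
  obtain ⟨hx0, hxa⟩ := Finset.mem_erase.1 hx
  obtain ⟨z, hz, rfl⟩ := Finset.mem_image.1 hxa
  exact ⟨z, hz, fun h => hx0 (by rw [h, h0]), rfl⟩

end Reindex

/-! ## §2. ★ The generic Z row floors -/

section Cells

variable {κ : Type*}

/-- ★★ **THE Z ROW FLOOR, branch 1 (refunds against the zone tail), generic over the grid.**  Hypotheses per grid point `k ∈ B`: template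
`MF k ⊆ Mrad ∋ o` (root, placed at `0`), unit normal, placed labels `2τ`-separated, template tubes below the plane (`hin`), tube floors `hvlo`
and refunds `hkw` on `Mrad`, envelopes `MF k ⊆ W⁺` (off-root floors `≤ 0` there) and `K ⊆ MF k ∖ o` (refunds `≥ 0`), the registry's mark at the
root of every coherent member (`hmark`), and ONE literal inequality over the envelopes.  Then every rooted `7/10`-hard-core `μ` of the row
satisfies `c + m ≤ rootEnergy V_LJ μ + net 0 (zonePull Hm R_Z) μ`.  Via (369) `floor_transport_of_zoneFloor₁'`; NASH unused. [folklore] -/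
theorem rowFloorZ₁_of_cells' (B : Set κ) (Mrad : Finset ι) (MF : κ → Finset ι) (o : ι) (posF : κ → ι → E3) (nF : κ → E3) (sF : κ → ℝ)
    (vlo kw : ι → ℝ) (Wp K : Finset ι) {τ Rw Rz c m : ℝ} (Hm : Measure E3 → E3 → Prop)
    (hshift : ∀ (ν : Measure E3) (y z : E3), Hm (ν.map fun x => x - y) z ↔ Hm ν (z + y))
    (hτ0 : 0 ≤ τ) (hτ : 2 * τ < 7 / 10) (hRz : 1 ≤ Rz) (hzw : Rz ≤ Rw)
    (hMF : ∀ k ∈ B, MF k ⊆ Mrad) (hoMF : ∀ k ∈ B, o ∈ MF k) (h0 : ∀ k ∈ B, posF k o = 0) (hn : ∀ k ∈ B, ‖nF k‖ = 1)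
    (hsep : ∀ k ∈ B, ∀ z ∈ Mrad, ∀ z' ∈ Mrad, z ≠ z' → 2 * τ < dist (posF k z) (posF k z'))
    (hin : ∀ k ∈ B, ∀ z ∈ MF k, ⟪posF k z, nF k⟫ + τ ≤ sF k)
    (hvlo : ∀ k ∈ B, ∀ z ∈ Mrad, z ≠ o → ∀ r : ℝ, ‖posF k z‖ - τ ≤ r → r ≤ ‖posF k z‖ + τ → vlo z ≤ lennardJones r)
    (hkw : ∀ k ∈ B, ∀ z ∈ Mrad, z ≠ o → 0 < kw z →
      Rz < ‖posF k z‖ - τ ∧ ‖posF k z‖ + τ ≤ Rw ∧ ∀ r : ℝ, ‖posF k z‖ - τ ≤ r → r ≤ ‖posF k z‖ + τ → kw z ≤ |lennardJones r|)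
    (hWp : ∀ k ∈ B, MF k ⊆ Wp) (hvlo0 : ∀ z ∈ Wp, z ≠ o → vlo z ≤ 0) (hK : ∀ k ∈ B, K ⊆ (MF k).erase o) (hkw0 : ∀ z ∈ Mrad, 0 ≤ kw z)
    (hmark : ∀ k ∈ B, ∀ μ : Measure E3, IsRootedHardCore (7 / 10) μ →
      μ ∈ coherentOn ((MF k).image (posF k)) τ (haloWindow (nF k) (sF k) Rw) → Hm μ 0)
    (hlit : 2 * (c + m) ≤ ∑ z ∈ Wp.erase o, vlo z - (tailCol Rz - ∑ z ∈ K, kw z))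
    (μ : Measure E3) (hμ : IsRootedHardCore (7 / 10) μ) (hrow : μ ∈ rowZ B MF posF nF sF τ Rw (7 / 10) Hm Rz) :
    c + m ≤ rootEnergy lennardJones μ + net 0 (zonePull Hm Rz) μ := by
  obtain ⟨k, hk, hcoh, hDF⟩ := exists_of_mem_rowZ hrow
  have hinjM : Set.InjOn (posF k) ↑Mrad := injOn_of_sep hτ0 (hsep k hk)
  have hinj : Set.InjOn (posF k) ↑(MF k) := hinjM.mono (Finset.coe_subset.2 (hMF k hk))
  have h0k := h0 k hk
  have h0a : (0 : E3) ∈ (MF k).image (posF k) := by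
    rw [← h0k]
    exact Finset.mem_image_of_mem _ (hoMF k hk)
  have ha : ∀ x ∈ (MF k).image (posF k), ∀ x' ∈ (MF k).image (posF k), x ≠ x' → 2 * τ < dist x x' := by
    intro x hx x' hx' hne
    obtain ⟨z, hz, rfl⟩ := Finset.mem_image.1 hx
    obtain ⟨z', hz', rfl⟩ := Finset.mem_image.1 hx'
    exact hsep k hk z (hMF k hk hz) z' (hMF k hk hz') fun h => hne (by rw [h])
  have hin' : ∀ x ∈ (MF k).image (posF k), ⟪x, nF k⟫ + τ ≤ sF k := by
    intro x hx
    obtain ⟨z, hz, rfl⟩ := Finset.mem_image.1 hx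
    exact hin k hk z hz
  have hvlo' : ∀ x ∈ ((MF k).image (posF k)).erase 0, ∀ r : ℝ, ‖x‖ - τ ≤ r → r ≤ ‖x‖ + τ →
      labOf (MF k) (posF k) vlo x ≤ lennardJones r := by
    intro x hx r h1 h2
    obtain ⟨z, hz, hzo, rfl⟩ := exists_label_of_mem_image_erase h0k hx
    rw [labOf_pos hinj (subset_refl _) vlo hz]
    exact hvlo k hk z (hMF k hk hz) hzo r h1 h2
  have hkw' : ∀ x ∈ ((MF k).image (posF k)).erase 0, 0 < labOf (MF k) (posF k) kw x →
      Rz < ‖x‖ - τ ∧ ‖x‖ + τ ≤ Rw ∧ ∀ r : ℝ, ‖x‖ - τ ≤ r → r ≤ ‖x‖ + τ → labOf (MF k) (posF k) kw x ≤ |lennardJones r| := by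
    intro x hx hpos
    obtain ⟨z, hz, hzo, rfl⟩ := exists_label_of_mem_image_erase h0k hx
    rw [labOf_pos hinj (subset_refl _) kw hz] at hpos ⊢
    exact hkw k hk z (hMF k hk hz) hzo hpos
  have hsumv := sum_labOf_image_erase hinj (hoMF k hk) h0k vlo
  have hsumk := sum_labOf_image_erase hinj (hoMF k hk) h0k kw
  have hv : ∑ z ∈ Wp.erase o, vlo z ≤ ∑ z ∈ (MF k).erase o, vlo z := sum_erase_le_of_subset_of_nonpos (hWp k hk) hvlo0
  have hkK : ∑ z ∈ K, kw z ≤ ∑ z ∈ (MF k).erase o, kw z :=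
    sum_le_of_subset_of_nonneg (hK k hk) fun z hz => hkw0 z (hMF k hk (Finset.mem_of_mem_erase hz))
  have hlit' : 2 * (c + m) ≤ ∑ x ∈ ((MF k).image (posF k)).erase 0, labOf (MF k) (posF k) vlo x -
      (tailCol Rz - ∑ x ∈ ((MF k).image (posF k)).erase 0, labOf (MF k) (posF k) kw x) := by
    rw [hsumv, hsumk]
    linarith
  exact floor_transport_of_zoneFloor₁' (labOf (MF k) (posF k) vlo) (labOf (MF k) (posF k) kw) Hm hshift (hn k hk) hμ hτ0 hτ hRz hzw hcoh
    h0a ha hin' hvlo' hkw' (hmark k hk μ hμ hcoh) (dFacing_pointwise (by norm_num) hDF) hlit'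

/-- ★★ **THE Z ROW FLOOR, branch 2 (half-space column, out-flow not collected).**  As branch 1 without refunds; `1 ≤ sF k`, `1 ≤ R_W`, and the
half-space column at the placed level bounded once for the cell (`hcol : halfEnergyCol (sF k) ≤ Hc`).  Via (369)
`floor_transport_of_zoneFloor₂'`. [folklore] -/
theorem rowFloorZ₂_of_cells' (B : Set κ) (Mrad : Finset ι) (MF : κ → Finset ι) (o : ι) (posF : κ → ι → E3) (nF : κ → E3) (sF : κ → ℝ)
    (vlo : ι → ℝ) (Wp : Finset ι) {τ Rw Rz c m Hc : ℝ} (Hm : Measure E3 → E3 → Prop)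
    (hshift : ∀ (ν : Measure E3) (y z : E3), Hm (ν.map fun x => x - y) z ↔ Hm ν (z + y))
    (hτ0 : 0 ≤ τ) (hτ : 2 * τ < 7 / 10) (hRw : 1 ≤ Rw)
    (hMF : ∀ k ∈ B, MF k ⊆ Mrad) (hoMF : ∀ k ∈ B, o ∈ MF k) (h0 : ∀ k ∈ B, posF k o = 0) (hn : ∀ k ∈ B, ‖nF k‖ = 1)
    (hs : ∀ k ∈ B, 1 ≤ sF k)
    (hsep : ∀ k ∈ B, ∀ z ∈ Mrad, ∀ z' ∈ Mrad, z ≠ z' → 2 * τ < dist (posF k z) (posF k z'))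
    (hin : ∀ k ∈ B, ∀ z ∈ MF k, ⟪posF k z, nF k⟫ + τ ≤ sF k)
    (hvlo : ∀ k ∈ B, ∀ z ∈ Mrad, z ≠ o → ∀ r : ℝ, ‖posF k z‖ - τ ≤ r → r ≤ ‖posF k z‖ + τ → vlo z ≤ lennardJones r)
    (hWp : ∀ k ∈ B, MF k ⊆ Wp) (hvlo0 : ∀ z ∈ Wp, z ≠ o → vlo z ≤ 0) (hcol : ∀ k ∈ B, halfEnergyCol (sF k) ≤ Hc)
    (hmark : ∀ k ∈ B, ∀ μ : Measure E3, IsRootedHardCore (7 / 10) μ →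
      μ ∈ coherentOn ((MF k).image (posF k)) τ (haloWindow (nF k) (sF k) Rw) → Hm μ 0)
    (hlit : 2 * (c + m) ≤ ∑ z ∈ Wp.erase o, vlo z - Hc - tailCol Rw)
    (μ : Measure E3) (hμ : IsRootedHardCore (7 / 10) μ) (hrow : μ ∈ rowZ B MF posF nF sF τ Rw (7 / 10) Hm Rz) :
    c + m ≤ rootEnergy lennardJones μ + net 0 (zonePull Hm Rz) μ := by
  obtain ⟨k, hk, hcoh, -⟩ := exists_of_mem_rowZ hrow
  have hinjM : Set.InjOn (posF k) ↑Mrad := injOn_of_sep hτ0 (hsep k hk)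
  have hinj : Set.InjOn (posF k) ↑(MF k) := hinjM.mono (Finset.coe_subset.2 (hMF k hk))
  have h0k := h0 k hk
  have h0a : (0 : E3) ∈ (MF k).image (posF k) := by
    rw [← h0k]
    exact Finset.mem_image_of_mem _ (hoMF k hk)
  have ha : ∀ x ∈ (MF k).image (posF k), ∀ x' ∈ (MF k).image (posF k), x ≠ x' → 2 * τ < dist x x' := by
    intro x hx x' hx' hne
    obtain ⟨z, hz, rfl⟩ := Finset.mem_image.1 hx
    obtain ⟨z', hz', rfl⟩ := Finset.mem_image.1 hx'
    exact hsep k hk z (hMF k hk hz) z' (hMF k hk hz') fun h => hne (by rw [h])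
  have hin' : ∀ x ∈ (MF k).image (posF k), ⟪x, nF k⟫ + τ ≤ sF k := by
    intro x hx
    obtain ⟨z, hz, rfl⟩ := Finset.mem_image.1 hx
    exact hin k hk z hz
  have hvlo' : ∀ x ∈ ((MF k).image (posF k)).erase 0, ∀ r : ℝ, ‖x‖ - τ ≤ r → r ≤ ‖x‖ + τ →
      labOf (MF k) (posF k) vlo x ≤ lennardJones r := by
    intro x hx r h1 h2
    obtain ⟨z, hz, hzo, rfl⟩ := exists_label_of_mem_image_erase h0k hx
    rw [labOf_pos hinj (subset_refl _) vlo hz]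
    exact hvlo k hk z (hMF k hk hz) hzo r h1 h2
  have hsumv := sum_labOf_image_erase hinj (hoMF k hk) h0k vlo
  have hv : ∑ z ∈ Wp.erase o, vlo z ≤ ∑ z ∈ (MF k).erase o, vlo z := sum_erase_le_of_subset_of_nonpos (hWp k hk) hvlo0
  have hlit' : 2 * (c + m) ≤ ∑ x ∈ ((MF k).image (posF k)).erase 0, labOf (MF k) (posF k) vlo x - halfEnergyCol (sF k) - tailCol Rw := by
    rw [hsumv]
    linarith [hcol k hk]
  exact floor_transport_of_zoneFloor₂' (labOf (MF k) (posF k) vlo) Hm hshift (hn k hk) (hs k hk) hμ hτ0 hτ hRw hcoh h0a ha hin' hvlo'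
    (hmark k hk μ hμ hcoh) hlit'

end Cells

/-! ## §3. ★★ The K-file form: tables over the grid-point templates -/

section Tables

variable {Mrad : Finset ι} {a : ι → Fin 3 → ℝ} {o : ι} {B : Set (Matrix (Fin 3) (Fin 3) ℝ)} {N : Set (Fin 3 → ℝ)} {J : Set ℝ}
variable {glo ghi rlo rhi vlo kw : ι → ℝ} {τ Nlo Nhi Slo Shi Rz Rw c m Hc : ℝ} {Hm : Measure E3 → E3 → Prop}

/-- ★★ **THE Z CELL FLOOR FROM TABLES, branch 1** (the `hfloor_KZ` of the registry line up to `eStar_le_cUp`).  Over the cell row set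
`cellRowZ Mrad a B N J τ R_W (7/10) Hm R_Z`: box brackets (`hNbr`, `hgbr`, `hrbr`), host separation on the strain box, the decided tables
(`htabv`, `htabk`, `hvlo0`, `hkw0`, `hpos`), the scalars `τ·N_hi ≤ S_lo`, `J ⊆ [S_lo, S_hi]`, the registry mark `hmark`, and the literal
`2(c + m) ≤ Σ_{W⁺∖o} vlo − (tailCol R_Z − Σ_K kw)`. [folklore] -/
theorem rowFloorZ₁_of_tables'
    (hshift : ∀ (ν : Measure E3) (y z : E3), Hm (ν.map fun x => x - y) z ↔ Hm ν (z + y))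
    (hτ0 : 0 ≤ τ) (hτ : 2 * τ < 7 / 10) (hRz : 1 ≤ Rz) (hzw : Rz ≤ Rw) (ho : o ∈ Mrad) (ho0 : a o = 0) (hNlo : 0 < Nlo)
    (hNbr : ∀ F ∈ B, ∀ n₁ ∈ N, Nlo ≤ ‖posL F n₁‖ ∧ ‖posL F n₁‖ ≤ Nhi)
    (hgbr : ∀ F ∈ B, ∀ n₁ ∈ N, ∀ z ∈ Mrad, glo z ≤ gram (F.transpose * F) (a z) n₁ ∧ gram (F.transpose * F) (a z) n₁ ≤ ghi z)
    (hrbr : ∀ F ∈ B, ∀ z ∈ Mrad, rlo z ≤ ‖posL F (a z)‖ ∧ ‖posL F (a z)‖ ≤ rhi z)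
    (hsep : ∀ F ∈ B, ∀ z ∈ Mrad, ∀ z' ∈ Mrad, z ≠ z' → 2 * τ < dist (posL F (a z)) (posL F (a z')))
    (hpos : ∀ z ∈ Mrad, z ≠ o → 0 < rlo z - τ)
    (htabv : ∀ z ∈ Mrad, z ≠ o → vlo z ≤
      (if rhi z + τ ≤ 1 then lennardJones (rhi z + τ) else if 1 ≤ rlo z - τ then lennardJones (rlo z - τ) else -1 / 12))
    (hvlo0 : ∀ z ∈ wPlus Mrad glo τ Nlo Shi, z ≠ o → vlo z ≤ 0)
    (htabk : ∀ z ∈ Mrad, z ≠ o → 0 < kw z → z ∈ kRef Mrad ghi rlo rhi τ Nhi Slo Rz Rw ∧ kw z ≤ -lennardJones (rhi z + τ))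
    (hkw0 : ∀ z ∈ Mrad, 0 ≤ kw z) (hroot : τ * Nhi ≤ Slo) (hJ : J ⊆ Set.Icc Slo Shi)
    (hmark : ∀ k ∈ gridZ B N J, ∀ μ : Measure E3, IsRootedHardCore (7 / 10) μ →
      μ ∈ coherentOn ((tplZ Mrad a τ k.1 k.2.1 k.2.2).image fun z => posL k.1 (a z)) τ (haloWindow (nL k.1 k.2.1) (sL k.1 k.2.1 k.2.2) Rw) →
        Hm μ 0)
    (hlit : 2 * (c + m) ≤ ∑ z ∈ (wPlus Mrad glo τ Nlo Shi).erase o, vlo z - (tailCol Rz - ∑ z ∈ kRef Mrad ghi rlo rhi τ Nhi Slo Rz Rw, kw z))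
    (μ : Measure E3) (hμ : IsRootedHardCore (7 / 10) μ) (hrow : μ ∈ cellRowZ Mrad a B N J τ Rw (7 / 10) Hm Rz) :
    c + m ≤ rootEnergy lennardJones μ + net 0 (zonePull Hm Rz) μ := by
  have hNpos : ∀ k ∈ gridZ B N J, 0 < ‖posL k.1 k.2.1‖ := fun k hk =>
    hNlo.trans_le (hNbr k.1 (boxes_of_mem_gridZ hk).1 k.2.1 (boxes_of_mem_gridZ hk).2.1).1
  refine rowFloorZ₁_of_cells' (gridZ B N J) Mrad (fun k => tplZ Mrad a τ k.1 k.2.1 k.2.2) o (fun k z => posL k.1 (a z))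
    (fun k => nL k.1 k.2.1) (fun k => sL k.1 k.2.1 k.2.2) vlo kw (wPlus Mrad glo τ Nlo Shi) (kRef Mrad ghi rlo rhi τ Nhi Slo Rz Rw) Hm hshift
    hτ0 hτ hRz hzw (fun k _ => tplZ_subset) (fun k hk => ?_) (fun k _ => by simp only [ho0, posL_zero]) (fun k hk => norm_nL k.1 k.2.1 (hNpos k hk))
    (fun k hk => hsep k.1 (boxes_of_mem_gridZ hk).1) (fun k hk z hz => inner_add_le_sL_of_mem_tplZ (hNpos k hk) hτ0 hz)
    (fun k hk => hvlo_of_table (hrbr k.1 (boxes_of_mem_gridZ hk).1) hpos htabv)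
    (fun k hk => hkw_of_table hRz (hrbr k.1 (boxes_of_mem_gridZ hk).1) htabk) (fun k hk => ?_) hvlo0 (fun k hk => ?_) hkw0 hmark hlit μ hμ
    hrow
  · -- the root label is a template point: `τ‖F n₁‖ ≤ τ N_hi ≤ S_lo ≤ S`
    obtain ⟨hF, hn, hS⟩ := boxes_of_mem_gridZ hk
    have h1 : τ * ‖posL k.1 k.2.1‖ ≤ τ * Nhi := mul_le_mul_of_nonneg_left (hNbr k.1 hF k.2.1 hn).2 hτ0
    exact mem_tplZ_root ho ho0 (h1.trans (hroot.trans (hJ hS).1))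
  · obtain ⟨hF, hn, hS⟩ := boxes_of_mem_gridZ hk
    exact tplZ_subset_wPlus hτ0 (fun z hz => (hgbr k.1 hF k.2.1 hn z hz).1) (hNbr k.1 hF k.2.1 hn).1 (hJ hS).2
  · obtain ⟨hF, hn, hS⟩ := boxes_of_mem_gridZ hk
    exact kRef_subset_tplZ_erase hτ0 (by linarith) (fun z hz => (hgbr k.1 hF k.2.1 hn z hz).2) (hNbr k.1 hF k.2.1 hn).2 (hJ hS).1
      (fun z hz => (hrbr k.1 hF z hz).1) ho0

/-- ★★ **THE Z CELL FLOOR FROM TABLES, branch 2** (half-space column; `N_hi ≤ S_lo` gives `1 ≤ sL`, `1 ≤ R_W`; the column bound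
`halfEnergyCol (sL F n₁ S) ≤ Hc` on the grid is the cell's one real-analysis fact, from `halfEnergyCol` antitone on `[1, ∞)` at `S_lo/N_hi`).
[folklore] -/
theorem rowFloorZ₂_of_tables'
    (hshift : ∀ (ν : Measure E3) (y z : E3), Hm (ν.map fun x => x - y) z ↔ Hm ν (z + y))
    (hτ0 : 0 ≤ τ) (hτ : 2 * τ < 7 / 10) (hRw : 1 ≤ Rw) (ho : o ∈ Mrad) (ho0 : a o = 0) (hNlo : 0 < Nlo)
    (hNbr : ∀ F ∈ B, ∀ n₁ ∈ N, Nlo ≤ ‖posL F n₁‖ ∧ ‖posL F n₁‖ ≤ Nhi)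
    (hgbr : ∀ F ∈ B, ∀ n₁ ∈ N, ∀ z ∈ Mrad, glo z ≤ gram (F.transpose * F) (a z) n₁ ∧ gram (F.transpose * F) (a z) n₁ ≤ ghi z)
    (hrbr : ∀ F ∈ B, ∀ z ∈ Mrad, rlo z ≤ ‖posL F (a z)‖ ∧ ‖posL F (a z)‖ ≤ rhi z)
    (hsep : ∀ F ∈ B, ∀ z ∈ Mrad, ∀ z' ∈ Mrad, z ≠ z' → 2 * τ < dist (posL F (a z)) (posL F (a z')))
    (hpos : ∀ z ∈ Mrad, z ≠ o → 0 < rlo z - τ)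
    (htabv : ∀ z ∈ Mrad, z ≠ o → vlo z ≤
      (if rhi z + τ ≤ 1 then lennardJones (rhi z + τ) else if 1 ≤ rlo z - τ then lennardJones (rlo z - τ) else -1 / 12))
    (hvlo0 : ∀ z ∈ wPlus Mrad glo τ Nlo Shi, z ≠ o → vlo z ≤ 0) (hroot : τ * Nhi ≤ Slo) (hone : Nhi ≤ Slo) (hJ : J ⊆ Set.Icc Slo Shi)
    (hcol : ∀ k ∈ gridZ B N J, halfEnergyCol (sL k.1 k.2.1 k.2.2) ≤ Hc)
    (hmark : ∀ k ∈ gridZ B N J, ∀ μ : Measure E3, IsRootedHardCore (7 / 10) μ →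
      μ ∈ coherentOn ((tplZ Mrad a τ k.1 k.2.1 k.2.2).image fun z => posL k.1 (a z)) τ (haloWindow (nL k.1 k.2.1) (sL k.1 k.2.1 k.2.2) Rw) →
        Hm μ 0)
    (hlit : 2 * (c + m) ≤ ∑ z ∈ (wPlus Mrad glo τ Nlo Shi).erase o, vlo z - Hc - tailCol Rw)
    (μ : Measure E3) (hμ : IsRootedHardCore (7 / 10) μ) (hrow : μ ∈ cellRowZ Mrad a B N J τ Rw (7 / 10) Hm Rz) :
    c + m ≤ rootEnergy lennardJones μ + net 0 (zonePull Hm Rz) μ := by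
  have hNpos : ∀ k ∈ gridZ B N J, 0 < ‖posL k.1 k.2.1‖ := fun k hk =>
    hNlo.trans_le (hNbr k.1 (boxes_of_mem_gridZ hk).1 k.2.1 (boxes_of_mem_gridZ hk).2.1).1
  refine rowFloorZ₂_of_cells' (gridZ B N J) Mrad (fun k => tplZ Mrad a τ k.1 k.2.1 k.2.2) o (fun k z => posL k.1 (a z))
    (fun k => nL k.1 k.2.1) (fun k => sL k.1 k.2.1 k.2.2) vlo (wPlus Mrad glo τ Nlo Shi) Hm hshift hτ0 hτ hRw (fun k _ => tplZ_subset)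
    (fun k hk => ?_) (fun k _ => by simp only [ho0, posL_zero]) (fun k hk => norm_nL k.1 k.2.1 (hNpos k hk)) (fun k hk => ?_)
    (fun k hk => hsep k.1 (boxes_of_mem_gridZ hk).1) (fun k hk z hz => inner_add_le_sL_of_mem_tplZ (hNpos k hk) hτ0 hz)
    (fun k hk => hvlo_of_table (hrbr k.1 (boxes_of_mem_gridZ hk).1) hpos htabv) (fun k hk => ?_) hvlo0 hcol hmark hlit μ hμ hrow
  · obtain ⟨hF, hn, hS⟩ := boxes_of_mem_gridZ hk
    have h1 : τ * ‖posL k.1 k.2.1‖ ≤ τ * Nhi := mul_le_mul_of_nonneg_left (hNbr k.1 hF k.2.1 hn).2 hτ0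
    exact mem_tplZ_root ho ho0 (h1.trans (hroot.trans (hJ hS).1))
  · obtain ⟨hF, hn, hS⟩ := boxes_of_mem_gridZ hk
    exact one_le_sL k.1 k.2.1 (hNpos k hk) (hNbr k.1 hF k.2.1 hn).2 (hone.trans (hJ hS).1)
  · obtain ⟨hF, hn, hS⟩ := boxes_of_mem_gridZ hk
    exact tplZ_subset_wPlus hτ0 (fun z hz => (hgbr k.1 hF k.2.1 hn z hz).1) (hNbr k.1 hF k.2.1 hn).1 (hJ hS).2

end Tables

end Summit.AtomisticToContinuum.Crystallization.Theorems.FrustratedLawDichotomyCellZFloorFrame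

end
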